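import Summits.FinalStateConjecture.FinalStateConjecture.Theorems.EIHFluxBalanceInertialRecessionRechartHover
import Summits.FinalStateConjecture.FinalStateConjecture.Theorems.EIHFluxBalanceInertialRecessionRechartKO
import Summits.FinalStateConjecture.FinalStateConjecture.Theorems.EIHFluxBalanceInertialRecessionRechartDictionary

/-!
# Route EIHFluxBalance — `InertialRecession`, re-charting: the causal properties of one
# re-charted `a = 0` hole chart (open embedding, certified static orbits, HOVER)

Helper file for the crux `stmt-FinalStateConjecture-10166`
(`Summit.FinalStateConjecture.FinalStateConjecture.Theses.EIHFluxBalance.InertialRecession`),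
stub `stub_rechart` (the transfer P2 of line `sublinear-is-free-clean-window-charges`).

For ONE hole `(M, V, ξ, v, Λ)` with the re-charting map `A` of `hole_chart_package2'` (exports:
`A` smooth open embedding into the late lab region, lab time `> T`, coverage, two-sided painted
radius, lab-time function `θ`), the hole chart `ψ = Φ ∘ A` on the boosted Schwarzschild background
`Kb` has the three properties the transfer (`…RechartTransfer`) consumes:

* `isOpenEmbedding_rechart` — `ψ` is an open embedding of the whole boosted exterior (the lab
  chart is an open embedding of the late lab region, `A` maps into it);
* `exists_isFutureDirected_static` — GIVEN (Ofut) future-orientation of the lab chart at the lab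
  points `A y`, the static push-forward `dψ(y)(Λ∞e₀)` is future-directed causal at every late model
  point with `r ≥ r₊ + δ` inside the certified radius `R(t*)` (near-zone `C⁰` convergence along
  `R`, `…RechartKO`);
* `exists_hover_rechart` — GIVEN moreover the LOITERING hypothesis (Hov) of hole `i` on the lab
  chart, every late model point of hole time `≤ τ₁` inside the certified radius lies in
  `J⁻(ψ{t* = τ₁, r ≤ R(τ₁)})` (`…RechartHover` + the dictionary `…RechartDictionary`).

[folklore]
-/

noncomputable section

set_option linter.dupNamespace false

open scoped Topology ContDiff InnerProductSpace Manifold ENNReal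
open Filter Set Metric Topology Function TopologicalSpace Literature.Geometry.Lorentzian

namespace Summit.FinalStateConjecture.FinalStateConjecture.Theorems

/-! ### Pointwise `C⁰` bound from the truncated `Cᵏ` deviation -/

/-- On the truncated slab through `y`, the `C⁰` deviation at `y` is bounded by the truncated `Cᵏ`
deviation. [folklore] -/
theorem norm_deviation_le_of_truncDeviationCk_le (𝓢 : Spacetime 4) (Kb : ModelBackground)
    (ψ : Kb.domain → 𝓢.carrier) (k : ℕ) {R c : ℝ} (hc : 0 ≤ c) (y : Kb.domain)
    (hyR : Kb.radius y.1 ≤ R)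
    (h : 𝓢.truncDeviationCk Kb ψ k R (Kb.time y.1) ≤ ENNReal.ofReal c) :
    ‖𝓢.deviation Kb ψ y‖ ≤ c := by
  have hmem : y.1 ∈ Subtype.val '' Kb.truncTimeSlab R (Kb.time y.1) :=
    mem_image_of_mem _ (show y ∈ Kb.truncTimeSlab R (Kb.time y.1) from ⟨rfl, hyR⟩)
  have h1 := enorm_iteratedFDeriv_le_supCkENorm (Nat.zero_le k) hmem (𝓢.deviationExtend Kb ψ)
  have h2 : ‖iteratedFDeriv ℝ 0 (𝓢.deviationExtend Kb ψ) y.1‖ₑ ≤ ENNReal.ofReal c := h1.trans h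
  rw [← ofReal_norm, norm_iteratedFDeriv_zero, Spacetime.deviationExtend_coe,
    ENNReal.ofReal_le_ofReal_iff hc] at h2
  exact h2

/-- Registered one-line form (stub `norm_deviation_le_of_truncDeviationCk` of the crux item) of
`norm_deviation_le_of_truncDeviationCk_le`. [folklore] -/
theorem norm_deviation_le_of_truncDeviationCk : open Literature.Geometry.Lorentzian in ∀ (𝓢 : Spacetime 4) (Kb : ModelBackground) (ψ : Kb.domain → 𝓢.carrier) (k : ℕ) {R c : ℝ}, 0 ≤ c → ∀ (y : Kb.domain), Kb.radius y.1 ≤ R → 𝓢.truncDeviationCk Kb ψ k R (Kb.time y.1) ≤ ENNReal.ofReal c → ‖𝓢.deviation Kb ψ y‖ ≤ c :=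
  fun 𝓢 Kb ψ k _ _ hc y hyR h ↦ norm_deviation_le_of_truncDeviationCk_le 𝓢 Kb ψ k hc y hyR h

/-! ### One re-charted hole -/

section HoleCausal

variable {𝓢 : Spacetime 4} (U : Opens E4) (Φ : U → 𝓢.carrier)
  (hΦ : ContMDiff 𝓘(ℝ, E4) (𝓡 4) ∞ Φ) {M : ℝ} (hM : 0 < M) {V : E3}
  (hV : ‖V‖ < 1) (ξ v : ℝ → E3) (hv1 : ∀ t, ‖v t‖ < 1) {κ₀ : ℝ} (hκ₀ : κ₀ < 1)
  (hvs : ∀ t, ‖v t‖ ≤ κ₀) (Λ : ℝ → lorentzGroup)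
  (hfut : ∀ t, 0 < (((Λ t : E4 ≃L[ℝ] E4) (E4.basisVector 0)) 0))
  (hvΛ : ∀ t, E4.spatial ((Λ t : E4 ≃L[ℝ] E4) (E4.basisVector 0)) =
    (((Λ t : E4 ≃L[ℝ] E4) (E4.basisVector 0)) 0) • v t)
  {A : E4 → E4} {T τ₀ : ℝ} {ρ θ : ℝ → ℝ} (hA : ContDiff ℝ ∞ A) (hAemb : IsOpenEmbedding A)
  (hAU : ∀ x ∈ (boostedKerrBackground (Lorentz.boost V hV) 0 M 0).domain, A x ∈ U)
  (hAT : ∀ x : E4, T < A x 0) (hτT : τ₀ ≤ T)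
  (hembΦ : IsOpenEmbedding (({x : U | τ₀ < x.1 0} : Set U).restrict Φ))
  (hcovA : ∀ x : E4, T + 1 ≤ x 0 →
    ‖E4.spatial x - ξ (x 0) + (Lorentz.gamma (v (x 0)) ^ 2 / (Lorentz.gamma (v (x 0)) + 1) *
      inner ℝ (v (x 0)) (E4.spatial x - ξ (x 0))) • v (x 0)‖ ≤ ρ (x 0) / 2 →
    ∃ x' : E4, A x' = x ∧ x' 0 = x 0 ∧
      E4.spatial ((Lorentz.boost V hV : E4 ≃L[ℝ] E4).symm x') = E4.spatial x - ξ (x 0) +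
        (Lorentz.gamma (v (x 0)) ^ 2 / (Lorentz.gamma (v (x 0)) + 1) *
          inner ℝ (v (x 0)) (E4.spatial x - ξ (x 0))) • v (x 0) ∧
      ((Lorentz.boost V hV : E4 ≃L[ℝ] E4).symm x') 0 =
        x 0 / Lorentz.gamma V - inner ℝ V (E4.spatial x - ξ (x 0) +
          (Lorentz.gamma (v (x 0)) ^ 2 / (Lorentz.gamma (v (x 0)) + 1) *
            inner ℝ (v (x 0)) (E4.spatial x - ξ (x 0))) • v (x 0)))
  (hrad2 : ∀ (x : E4) (Λ' : lorentzGroup), 0 < ((Λ' : E4 ≃L[ℝ] E4) (E4.basisVector 0)) 0 →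
    E4.spatial ((Λ' : E4 ≃L[ℝ] E4) (E4.basisVector 0)) =
      (((Λ' : E4 ≃L[ℝ] E4) (E4.basisVector 0)) 0) • v (A x 0) →
    min ‖E4.spatial ((Lorentz.boost V hV : E4 ≃L[ℝ] E4).symm x)‖ (ρ (A x 0) / 2) ≤
        E4.spatialNorm ((Λ' : E4 ≃L[ℝ] E4).symm (A x - E4.ofTimeSpace (A x 0) (ξ (A x 0)))) ∧
      E4.spatialNorm ((Λ' : E4 ≃L[ℝ] E4).symm (A x - E4.ofTimeSpace (A x 0) (ξ (A x 0)))) ≤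
        ‖E4.spatial ((Lorentz.boost V hV : E4 ≃L[ℝ] E4).symm x)‖)
  (hAθ : ∀ x : E4, A x 0 = θ (x 0)) (hθid : ∀ s, T + 1 ≤ s → θ s = s)
  (hθ' : ∀ s, 0 < deriv θ s) (hDA : ∀ x w : E4, (fderiv ℝ A x w) 0 = deriv θ (x 0) * w 0)
  (hρt : Tendsto ρ atTop atTop)
  -- future-orientation of the lab chart at the lab points of the hole chart
  (Q : U → Prop)
  (hOfut : ∀ x : U, Q x → ∀ w : E4, 0 < w 0 →
    𝓢.metric.val (Φ x) (mfderiv 𝓘(ℝ, E4) (𝓡 4) Φ x w) (mfderiv 𝓘(ℝ, E4) (𝓡 4) Φ x w) < 0 →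
      𝓢.timeOrientation.IsFutureDirected (mfderiv 𝓘(ℝ, E4) (𝓡 4) Φ x w))
  (hQA : ∀ y : (boostedKerrBackground (Lorentz.boost V hV) 0 M 0).domain, Q ⟨A y.1, hAU y.1 y.2⟩)
  -- certified radii and near-zone convergence along them
  (R : ℝ → ℝ) (hRm : Monotone R) (hRt : Tendsto R atTop atTop)
  (hconv : Tendsto (fun τ ↦ 𝓢.truncDeviationCk (boostedKerrBackground (Lorentz.boost V hV) 0 M 0)
    (fun y ↦ Φ ⟨A y.1, hAU y.1 y.2⟩) 2 (R τ) τ) atTop (𝓝 0))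

include hAemb hAT hτT hembΦ in
/-- **The re-charted hole chart is an open embedding** of the whole boosted exterior. [folklore] -/
theorem isOpenEmbedding_rechart :
    IsOpenEmbedding (fun y : (boostedKerrBackground (Lorentz.boost V hV) 0 M 0).domain ↦
      Φ ⟨A y.1, hAU y.1 y.2⟩) := by
  set L : Set U := {x : U | τ₀ < x.1 0} with hL
  have hLo : IsOpen L :=
    isOpen_lt continuous_const ((PiLp.continuous_apply 2 _ 0).comp continuous_subtype_val)
  let g : (boostedKerrBackground (Lorentz.boost V hV) 0 M 0).domain → L :=
    fun y ↦ ⟨⟨A y.1, hAU y.1 y.2⟩, by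
      show τ₀ < A y.1 0
      exact hτT.trans_lt (hAT y.1)⟩
  have he : IsOpenEmbedding (fun z : L ↦ (z.1.1 : E4)) :=
    U.isOpen.isOpenEmbedding_subtypeVal.comp hLo.isOpenEmbedding_subtypeVal
  have hcomp : IsOpenEmbedding ((fun z : L ↦ (z.1.1 : E4)) ∘ g) := by
    have : ((fun z : L ↦ (z.1.1 : E4)) ∘ g) = A ∘ Subtype.val := rfl
    rw [this]
    exact hAemb.comp
      (boostedKerrBackground (Lorentz.boost V hV) 0 M 0).domain.isOpen.isOpenEmbedding_subtypeVal
  have hg : IsOpenEmbedding g := IsOpenEmbedding.of_comp g he hcomp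
  exact hembΦ.comp hg

include hΦ hM hA hθ' hDA hOfut hQA hconv in
/-- **Certified static orbits of the re-charted hole chart.** For every `δ > 0` there is a hole
time `S₀` after which, at every model point with `r ≥ r₊ + δ` inside the certified radius `R(t*)`,
the static push-forward `dψ(y)(Λ∞e₀)` is future-directed causal. [folklore] -/
theorem exists_isFutureDirected_static {δ : ℝ} (hδ : 0 < δ) :
    ∃ S₀ : ℝ, ∀ y : (boostedKerrBackground (Lorentz.boost V hV) 0 M 0).domain,
      S₀ ≤ (boostedKerrBackground (Lorentz.boost V hV) 0 M 0).time y.1 →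
      Kerr.rPlus M 0 + δ ≤ (boostedKerrBackground (Lorentz.boost V hV) 0 M 0).radius y.1 →
      (boostedKerrBackground (Lorentz.boost V hV) 0 M 0).radius y.1 ≤
        R ((boostedKerrBackground (Lorentz.boost V hV) 0 M 0).time y.1) →
      𝓢.timeOrientation.IsFutureDirected (mfderiv 𝓘(ℝ, E4) (𝓡 4)
        (fun y : (boostedKerrBackground (Lorentz.boost V hV) 0 M 0).domain ↦ Φ ⟨A y.1, hAU y.1 y.2⟩)
          y ((Lorentz.boost V hV : E4 ≃L[ℝ] E4) (E4.basisVector 0))) := by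
  set u : E4 := (Lorentz.boost V hV : E4 ≃L[ℝ] E4) (E4.basisVector 0) with hu
  set m : ℝ := δ / (2 * M + δ) with hm
  have hm0 : 0 < m := by rw [hm]; positivity
  set c : ℝ := m / (2 * (‖u‖ ^ 2 + 1)) with hc
  have hc0 : 0 < c := by rw [hc]; positivity
  have hcm : c * ‖u‖ ^ 2 < m := by
    rw [hc]
    have h1 : m / (2 * (‖u‖ ^ 2 + 1)) * ‖u‖ ^ 2 = m * (‖u‖ ^ 2 / (2 * (‖u‖ ^ 2 + 1))) := by ring
    rw [h1]
    have h2 : ‖u‖ ^ 2 / (2 * (‖u‖ ^ 2 + 1)) < 1 := by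
      rw [div_lt_one (by positivity)]; nlinarith [sq_nonneg ‖u‖]
    nlinarith
  -- eventual smallness of the deviation
  obtain ⟨S₀, hS₀⟩ := (ENNReal.tendsto_atTop_zero.mp hconv) (ENNReal.ofReal c)
    (ENNReal.ofReal_pos.mpr hc0)
  refine ⟨S₀, fun y hyS hyr hyR ↦ ?_⟩
  have hdev : ‖𝓢.deviation (boostedKerrBackground (Lorentz.boost V hV) 0 M 0)
      (fun y ↦ Φ ⟨A y.1, hAU y.1 y.2⟩) y‖ ≤ c :=
    norm_deviation_le_of_truncDeviationCk_le 𝓢 _ _ 2 hc0.le y hyR (hS₀ _ hyS)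
  have hA0 : 0 < (fderiv ℝ A y.1 u) 0 := by
    rw [hDA, hu, Lorentz.boost_apply_basisVector_zero_zero]
    exact mul_pos (hθ' _) (Lorentz.gamma_pos hV)
  have hyr' : 2 * M + δ ≤ (boostedKerrBackground (Lorentz.boost V hV) 0 M 0).radius y.1 := by
    rw [← Kerr.rPlus_zero_right hM.le]; exact hyr
  exact isFutureDirected_mfderiv_comp_of_deviation _ U Φ hΦ hA hAU Q hOfut y u (hQA y) hA0
    (bilin_boosted_static_le hV M hM hδ y.1 hyr') hcm hdev

include hΦ hM hv1 hκ₀ hvs hfut hvΛ hA hAemb hAT hτT hembΦ hcovA hrad2 hAθ hθid hθ' hDA hρt hOfut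
  hQA hRm hRt hconv in
/-- **HOVER for the re-charted hole chart.** Granted (Ofut) and the loitering hypothesis (Hov)
of the hole on the lab chart (with `Pext` any lab predicate holding at the lab points of the
hole chart — "outside every painted horizon"), there are hole times `S`, `τh` such that every
model point `y` with `S ≤ t*(y) ≤ τ₁`, `τh ≤ τ₁`, `r(y) ≤ R(t*(y))` lies in the causal past of
the certified tilted slab `ψ({t* = τ₁, r ≤ R(τ₁)})`. [folklore] -/
theorem exists_hover_rechart (Pext : U → Prop)
    (hPextA : ∀ y : (boostedKerrBackground (Lorentz.boost V hV) 0 M 0).domain,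
      Pext ⟨A y.1, hAU y.1 y.2⟩)
    {δ K TH : ℝ} (hδ : 0 < δ) (hδK : Kerr.rPlus M 0 + δ < K)
    (hHov : ∀ x : U, TH < x.1 0 → Pext x →
      Kerr.radius 0 (poincareInv (Λ (x.1 0)) (E4.ofTimeSpace (x.1 0) (ξ (x.1 0))) x.1) <
        Kerr.rPlus M 0 + δ → ∀ s : ℝ, 0 < s →
      ∃ (γ : ℝ → 𝓢.carrier) (b : ℝ), 0 < b ∧
        𝓢.metric.IsFutureCausalCurveOn 𝓢.timeOrientation γ (Icc 0 b) ∧ γ 0 = Φ x ∧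
        γ b ∈ Φ '' {z : U | z.1 0 = x.1 0 + s ∧
          Kerr.rPlus M 0 <
            Kerr.radius 0 (poincareInv (Λ (z.1 0)) (E4.ofTimeSpace (z.1 0) (ξ (z.1 0))) z.1) ∧
          Kerr.radius 0 (poincareInv (Λ (z.1 0)) (E4.ofTimeSpace (z.1 0) (ξ (z.1 0))) z.1) < K} ∧
        ∀ σ ∈ Icc 0 b, γ σ ∈ Φ '' {z : U | x.1 0 ≤ z.1 0 ∧
          Kerr.rPlus M 0 <
            Kerr.radius 0 (poincareInv (Λ (z.1 0)) (E4.ofTimeSpace (z.1 0) (ξ (z.1 0))) z.1) ∧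
          Kerr.radius 0 (poincareInv (Λ (z.1 0)) (E4.ofTimeSpace (z.1 0) (ξ (z.1 0))) z.1) < K}) :
    ∃ S τh : ℝ, ∀ (y : (boostedKerrBackground (Lorentz.boost V hV) 0 M 0).domain) (τ₁ : ℝ),
      τh ≤ τ₁ → S ≤ (boostedKerrBackground (Lorentz.boost V hV) 0 M 0).time y.1 →
      (boostedKerrBackground (Lorentz.boost V hV) 0 M 0).time y.1 ≤ τ₁ →
      (boostedKerrBackground (Lorentz.boost V hV) 0 M 0).radius y.1 ≤
        R ((boostedKerrBackground (Lorentz.boost V hV) 0 M 0).time y.1) →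
      Φ ⟨A y.1, hAU y.1 y.2⟩ ∈ 𝓢.metric.causalPast 𝓢.timeOrientation
        ((fun y : (boostedKerrBackground (Lorentz.boost V hV) 0 M 0).domain ↦
          Φ ⟨A y.1, hAU y.1 y.2⟩) ''
          (boostedKerrBackground (Lorentz.boost V hV) 0 M 0).truncTimeSlab (R τ₁) τ₁) := by
  -- notation
  set Kb := boostedKerrBackground (Lorentz.boost V hV) 0 M 0 with hKb
  set γ₀ : ℝ := (Real.sqrt (1 - κ₀ ^ 2))⁻¹ with hγ₀
  have hκ : 0 ≤ κ₀ := (norm_nonneg (v 0)).trans (hvs 0)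
  have hγ₀1 : 1 ≤ γ₀ := one_le_inv_sqrt_one_sub_sq hκ hκ₀
  have hγ := Lorentz.gamma_pos hV
  have hγ1 := Lorentz.one_le_gamma hV
  have hrp0 : 0 < Kerr.rPlus M 0 := by rw [Kerr.rPlus_zero_right hM.le]; linarith
  have hK0 : 0 < K := by linarith
  -- certified static orbits
  obtain ⟨S₀, hS₀⟩ := exists_isFutureDirected_static U Φ hΦ hM hV hA hAU hθ' hDA Q hOfut hQA R
    hconv hδ
  -- thresholds
  obtain ⟨TK, hTK⟩ := eventually_atTop.1 (tendsto_atTop.1 hρt (2 * γ₀ * K))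
  obtain ⟨τh, hτh⟩ := eventually_atTop.1 (tendsto_atTop.1 hRt K)
  set Tc : ℝ := max (T + 1) TK with hTc
  set S₁ : ℝ := max (max TH Tc) 0 + 1 + ‖V‖ * K with hS₁
  -- coverage of the painted near zone below radius `K`
  have hcov : ∀ z : U, Tc ≤ z.1 0 →
      Kerr.rPlus M 0 < Kerr.radius 0 (poincareInv (Λ (z.1 0)) (E4.ofTimeSpace (z.1 0) (ξ (z.1 0))) z.1) →
      Kerr.radius 0 (poincareInv (Λ (z.1 0)) (E4.ofTimeSpace (z.1 0) (ξ (z.1 0))) z.1) < K →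
      ∃ y : Kb.domain, Φ ⟨A y.1, hAU y.1 y.2⟩ = Φ z ∧
        Kb.radius y.1 = Kerr.radius 0 (poincareInv (Λ (z.1 0)) (E4.ofTimeSpace (z.1 0) (ξ (z.1 0))) z.1) ∧
        |Kb.time y.1 - (Lorentz.gamma V)⁻¹ * z.1 0| ≤
          ‖V‖ * Kerr.radius 0 (poincareInv (Λ (z.1 0)) (E4.ofTimeSpace (z.1 0) (ξ (z.1 0))) z.1) := by
    intro z hz hzr hzK
    refine exists_model_of_lab U Φ hM hV ξ v hv1 hκ₀ hvs Λ hfut hvΛ hAU hcovA hrad2 z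
      ((le_max_left _ _).trans hz) hzr ?_
    have h1 := hTK (z.1 0) ((le_max_right _ _).trans hz)
    have h2 : γ₀ * Kerr.radius 0 (poincareInv (Λ (z.1 0)) (E4.ofTimeSpace (z.1 0) (ξ (z.1 0))) z.1) ≤
        γ₀ * K := mul_le_mul_of_nonneg_left hzK.le (zero_le_one.trans hγ₀1)
    linarith
  -- the lab description of the near-horizon model points
  have hlab : ∀ y : Kb.domain, S₁ ≤ Kb.time y.1 → Kb.radius y.1 < Kerr.rPlus M 0 + δ →
      ∃ x : U, Φ x = Φ ⟨A y.1, hAU y.1 y.2⟩ ∧ TH < x.1 0 ∧ Tc ≤ x.1 0 ∧ Pext x ∧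
        Kerr.radius 0 (poincareInv (Λ (x.1 0)) (E4.ofTimeSpace (x.1 0) (ξ (x.1 0))) x.1) =
          Kb.radius y.1 ∧
        |Kb.time y.1 - (Lorentz.gamma V)⁻¹ * x.1 0| ≤
          ‖V‖ * Kerr.radius 0 (poincareInv (Λ (x.1 0)) (E4.ofTimeSpace (x.1 0) (ξ (x.1 0))) x.1) := by
    intro y hyS hyr
    have hrK : Kb.radius y.1 < K := hyr.trans hδK
    -- `y⁰` is large
    have hy0 : max (max TH Tc) 0 + 1 ≤ y.1 0 := by
      have h1 := apply_zero_ge_of_model (M := M) hV y.1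
      have h2 : max (max TH Tc) 0 + 1 ≤ Kb.time y.1 - ‖V‖ * Kb.radius y.1 := by
        have : ‖V‖ * Kb.radius y.1 ≤ ‖V‖ * K := mul_le_mul_of_nonneg_left hrK.le (norm_nonneg _)
        rw [hS₁] at hyS; linarith
      have h3 : 0 ≤ Kb.time y.1 - ‖V‖ * Kb.radius y.1 := by
        linarith [le_max_right (max TH Tc) 0]
      nlinarith
    have hyT : T + 1 ≤ y.1 0 := by
      linarith [le_max_left (T + 1) TK, le_max_right TH Tc, le_max_left (max TH Tc) 0]
    have hyTK : TK ≤ y.1 0 := by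
      linarith [le_max_right (T + 1) TK, le_max_right TH Tc, le_max_left (max TH Tc) 0]
    have hyρ : Kb.radius y.1 ≤ ρ (y.1 0) / 2 := by
      have h1 := hTK _ hyTK
      nlinarith
    obtain ⟨hA0, hrad, htime⟩ := lab_of_model hV ξ v Λ hfut hvΛ hrad2 hAθ hθid y hyT hyρ
    refine ⟨⟨A y.1, hAU y.1 y.2⟩, rfl, ?_, ?_, hPextA y, hrad, ?_⟩
    · show TH < A y.1 0
      rw [hA0]; linarith [le_max_left TH Tc, le_max_left (max TH Tc) 0]
    · show Tc ≤ A y.1 0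
      rw [hA0]; linarith [le_max_right TH Tc, le_max_left (max TH Tc) 0]
    · show |Kb.time y.1 - (Lorentz.gamma V)⁻¹ * A y.1 0| ≤ ‖V‖ * _
      rw [hrad, hA0]; exact htime
  -- assemble
  refine ⟨max S₀ S₁, τh, fun y τ₁ hτ₁ hyS hy₁ hyR ↦ ?_⟩
  have hemb := isOpenEmbedding_rechart U Φ hV hAemb hAU hAT hτT hembΦ
  exact mem_causalPast_image_truncTimeSlab Kb ((Lorentz.boost V hV : E4 ≃L[ℝ] E4) (E4.basisVector 0))
    (fun x hx σ ↦ kb_boosted_static_mem hV M x hx σ) (kb_boosted_static_time hV M)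
    (kb_boosted_static_radius hV M) _ (contMDiff_comp_smooth hA hAU (fun _ ↦ rfl) hΦ) hemb
    (continuous_kb_boosted_time hV M) U Φ
    (fun x ↦ Kerr.radius 0 (poincareInv (Λ (x.1 0)) (E4.ofTimeSpace (x.1 0) (ξ (x.1 0))) x.1))
    Pext R hRm (norm_nonneg V) (inv_pos.mpr hγ) hδK.le hS₀ hHov hcov hlab y
    ((le_max_left _ _).trans hyS) ((le_max_right _ _).trans hyS) hyR hy₁ (hτh τ₁ hτ₁)

end HoleCausal

end Summit.FinalStateConjecture.FinalStateConjecture.Theorems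

end
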